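import Summits.FinalStateConjecture.FinalStateConjecture.Theorems.UniformPhotonSphereChannels.Negative.CauchyC3
import Summits.FinalStateConjecture.FinalStateConjecture.Theorems.UniformPhotonSphereChannels.Negative.Cutoff
import Summits.FinalStateConjecture.FinalStateConjecture.Theorems.PhotonSphereChannelsRWPotential
import Literature.Geometry.Lorentzian.ReggeWheelerTortoise

/-!
# Crux `UniformPhotonSphereChannels` (K1), negative side — the witness: bump data, the even
# solution, and the size of the data energy

Support file of the standing disprover of item stmt-FinalStateConjecture-10045.

* `exists_data`: smooth bump data `g` supported in `(−ρ − 7M/10, −ρ − M/2)` and `= 1` on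
  `[−ρ − 13M/20, −ρ − 11M/20]`;
* `exists_solution`: for the spin-1 Regge–Wheeler potential `V = L(1 − 2M/r)/r²` (bounded by
  `L/4M²`, smooth) the global even `C³` solution with data `(g, 0)` and its light cone
  (`Blindness.exists_even_solution_C3`);
* `data_energy_ge`: the tortoise energy of the data dominates `L · G₂`,
  `G₂ = ∫ (1 − 2M/r) g²/r² > 0` independent of `L` (`data_weight_pos`). [folklore]
-/

namespace Summit.FinalStateConjecture.FinalStateConjecture.Theorems

open Set Filter Topology MeasureTheory intervalIntegral Literature.Geometry.Lorentzian.ReggeWheeler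

noncomputable section

namespace WaveDefect

open WaveEnergy

/-- **Bump data** placed at tortoise distance `≈ 3M/5` inside `x = −ρ`. -/
theorem exists_data (M ρ : ℝ) (hM : 0 < M) : ∃ g : ℝ → ℝ, ContDiff ℝ 3 g ∧ HasCompactSupport g ∧
    (∀ x, x ∉ Ioo (-ρ - 7 / 10 * M) (-ρ - 1 / 2 * M) → g x = 0) ∧
    (∀ x, x ∈ Icc (-ρ - 13 / 20 * M) (-ρ - 11 / 20 * M) → g x = 1) := by
  obtain ⟨g, hg, hgc, hg0, hg1⟩ := exists_bump (-ρ - 3 / 5 * M) (R := M / 10) (by positivity)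
  refine ⟨g, hg, hgc, fun x hx => hg0 x ?_, fun x hx => hg1 x ?_⟩
  · rwa [show -ρ - 3 / 5 * M - M / 10 = -ρ - 7 / 10 * M by ring,
      show -ρ - 3 / 5 * M + M / 10 = -ρ - 1 / 2 * M by ring]
  · rwa [show -ρ - 3 / 5 * M - M / 10 / 2 = -ρ - 13 / 20 * M by ring,
      show -ρ - 3 / 5 * M + M / 10 / 2 = -ρ - 11 / 20 * M by ring]

/-- The spin-1 Regge–Wheeler potential is smooth, non-negative and bounded by `L/4M²`. -/
theorem rwPotentialOne_props {M : ℝ} {r : ℝ → ℝ} (h : IsTortoiseRadius M r 0) {L : ℝ}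
    (hL : 0 ≤ L) :
    ContDiff ℝ 2 (fun x => (1 - 2 * M / r x) * (L / r x ^ 2)) ∧
    (∀ x, 0 ≤ (1 - 2 * M / r x) * (L / r x ^ 2)) ∧
    (∀ x, |(1 - 2 * M / r x) * (L / r x ^ 2)| ≤ L / (4 * M ^ 2)) := by
  have hM := h.mass_pos
  have hr2 : ContDiff ℝ 2 r := by
    have := tortoise_contDiff hM h.two_mul_lt h.hasDerivAt h.center 2
    simpa using this
  have hr0 : ∀ x, r x ≠ 0 := fun x => (h.pos x).ne'
  have hV0 : ∀ x, 0 ≤ (1 - 2 * M / r x) * (L / r x ^ 2) := fun x =>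
    mul_nonneg (h.deriv_pos x).le (div_nonneg hL (sq_nonneg _))
  refine ⟨(contDiff_const.sub (contDiff_const.div hr2 hr0)).mul
      (contDiff_const.div (hr2.pow 2) fun x => pow_ne_zero 2 (hr0 x)), hV0, fun x => ?_⟩
  rw [abs_of_nonneg (hV0 x)]
  have h1 : 1 - 2 * M / r x ≤ 1 := (h.deriv_lt_one x).le
  have h2 : L / r x ^ 2 ≤ L / (4 * M ^ 2) := by
    apply div_le_div_of_nonneg_left hL (by positivity)
    have := h.two_mul_lt x
    nlinarith
  calc (1 - 2 * M / r x) * (L / r x ^ 2) ≤ 1 * (L / r x ^ 2) :=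
        mul_le_mul_of_nonneg_right h1 (div_nonneg hL (sq_nonneg _))
    _ ≤ L / (4 * M ^ 2) := by rw [one_mul]; exact h2

/-- **The even solution with bump data** for the spin-1 Regge–Wheeler potential. -/
theorem exists_solution {M : ℝ} {r : ℝ → ℝ} (h : IsTortoiseRadius M r 0) {L : ℝ} (hL : 0 ≤ L)
    {ρ : ℝ} {g : ℝ → ℝ} (hg : ContDiff ℝ 3 g)
    (hg0 : ∀ x, x ∉ Ioo (-ρ - 7 / 10 * M) (-ρ - 1 / 2 * M) → g x = 0) :
    ∃ ψ : ℝ → ℝ → ℝ, ContDiff ℝ 3 (Function.uncurry ψ) ∧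
      (∀ t x, iteratedDeriv 2 (fun τ => ψ τ x) t - iteratedDeriv 2 (ψ t) x
        + (1 - 2 * M / r x) * (L / r x ^ 2) * ψ t x = 0) ∧
      (∀ x, ψ 0 x = g x) ∧ (∀ x, deriv (fun τ => ψ τ x) 0 = 0) ∧
      (∀ t x, ψ (-t) x = ψ t x) ∧
      (∀ t x, (x < (-ρ - 7 / 10 * M) - |t| ∨ (-ρ - 1 / 2 * M) + |t| < x) → ψ t x = 0) := by
  obtain ⟨hV2, -, hVb⟩ := rwPotentialOne_props h hL
  exact Blindness.exists_even_solution_C3 (V := fun x => (1 - 2 * M / r x) * (L / r x ^ 2))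
    hV2 hVb hg fun x hx => hg0 x fun hx' => hx (Ioo_subset_Icc_self hx')

/-- **The data weight `G₂ = ∫ (1 − 2M/r) g²/r²` is positive.** -/
theorem data_weight_pos {M : ℝ} {r : ℝ → ℝ} (h : IsTortoiseRadius M r 0) {ρ : ℝ} {g : ℝ → ℝ}
    (hg : ContDiff ℝ 3 g) (hg1 : ∀ x, x ∈ Icc (-ρ - 13 / 20 * M) (-ρ - 11 / 20 * M) → g x = 1) :
    0 < ∫ x in (-ρ - 4 / 5 * M)..(-ρ - 2 / 5 * M), (1 - 2 * M / r x) * (1 / r x ^ 2) * g x ^ 2 := by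
  have hM := h.mass_pos
  obtain ⟨-, hV0, -⟩ := rwPotentialOne_props h zero_le_one
  have hVpos : ∀ x, 0 < (1 - 2 * M / r x) * (1 / r x ^ 2) := fun x =>
    mul_pos (h.deriv_pos x) (div_pos one_pos (pow_pos (h.pos x) 2))
  have hfc : Continuous fun x => (1 - 2 * M / r x) * (1 / r x ^ 2) * g x ^ 2 := by
    have hr := h.continuous
    have hr0 : ∀ x, r x ≠ 0 := fun x => (h.pos x).ne'
    exact ((continuous_const.sub (continuous_const.div hr hr0)).mul
      (continuous_const.div (hr.pow 2) fun x => pow_ne_zero 2 (hr0 x))).mul (hg.continuous.pow 2)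
  have hf0 : ∀ x, 0 ≤ (1 - 2 * M / r x) * (1 / r x ^ 2) * g x ^ 2 := fun x =>
    mul_nonneg (hV0 x) (sq_nonneg _)
  have hsub : ∫ x in (-ρ - 13 / 20 * M)..(-ρ - 11 / 20 * M), (1 - 2 * M / r x) * (1 / r x ^ 2) * g x ^ 2
      ≤ ∫ x in (-ρ - 4 / 5 * M)..(-ρ - 2 / 5 * M), (1 - 2 * M / r x) * (1 / r x ^ 2) * g x ^ 2 :=
    intervalIntegral_mono_of_nonneg hfc hf0 (by linarith) (by linarith) (by linarith)
  refine lt_of_lt_of_le ?_ hsub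
  refine intervalIntegral.intervalIntegral_pos_of_pos_on (hfc.intervalIntegrable _ _) ?_ (by linarith)
  intro x hx
  rw [hg1 x (Ioo_subset_Icc_self hx), one_pow, mul_one]
  exact hVpos x

/-- **The tortoise energy of the data dominates `L · G₂`.** -/
theorem data_energy_ge {M : ℝ} {r : ℝ → ℝ} (h : IsTortoiseRadius M r 0) (L : ℝ)
    {ρ : ℝ} {g : ℝ → ℝ} (hg : ContDiff ℝ 3 g) :
    L * ∫ x in (-ρ - 4 / 5 * M)..(-ρ - 2 / 5 * M), (1 - 2 * M / r x) * (1 / r x ^ 2) * g x ^ 2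
      ≤ ∫ x in (-ρ - 4 / 5 * M)..(-ρ - 2 / 5 * M),
          (deriv g x ^ 2 + (1 - 2 * M / r x) * (L / r x ^ 2) * g x ^ 2) := by
  have hM := h.mass_pos
  have hr := h.continuous
  have hr0 : ∀ x, r x ≠ 0 := fun x => (h.pos x).ne'
  have hV1c : Continuous fun x => (1 - 2 * M / r x) * (1 / r x ^ 2) :=
    (continuous_const.sub (continuous_const.div hr hr0)).mul
      (continuous_const.div (hr.pow 2) fun x => pow_ne_zero 2 (hr0 x))
  have hVc : Continuous fun x => (1 - 2 * M / r x) * (L / r x ^ 2) :=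
    (continuous_const.sub (continuous_const.div hr hr0)).mul
      (continuous_const.div (hr.pow 2) fun x => pow_ne_zero 2 (hr0 x))
  have hg'c : Continuous (deriv g) := hg.continuous_deriv (by norm_num)
  rw [← intervalIntegral.integral_const_mul]
  refine intervalIntegral.integral_mono_on (by linarith)
    ((continuous_const.mul (hV1c.mul (hg.continuous.pow 2))).intervalIntegrable _ _)
    (((hg'c.pow 2).add (hVc.mul (hg.continuous.pow 2))).intervalIntegrable _ _) fun x _ => ?_
  have hid : L * ((1 - 2 * M / r x) * (1 / r x ^ 2) * g x ^ 2)
      = (1 - 2 * M / r x) * (L / r x ^ 2) * g x ^ 2 := by ring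
  rw [hid]
  linarith [sq_nonneg (deriv g x)]

end WaveDefect

end

end Summit.FinalStateConjecture.FinalStateConjecture.Theorems
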